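import Summits.Ventures.HodgeRepro2.T5CongruenceConjugation
import Summits.Ventures.HodgeRepro2.T5CartanTransposeGelfand

/-!
# Finiteness of `KgK/K` for `K = GL_n(R)`, and the commutativity of `H(GL_n(F), GL_n(R))`

Tier-5 kernel support (blind cell pub-hodge-repro2, seat p8, gen 11). Third step: the
hypothesis `hfin` of `T5CartanTransposeGelfand.heckeAlgebra_mul_comm` — every double-coset
space `KgK/K` is finite — is discharged for `K = GL_n(R)` inside `GL_n(F)` from the single
arithmetic input

  `(Q)  R ⧸ (c)` is finite for every `c ≠ 0`

(true for the record's `𝒪_v`, a discrete valuation ring with finite residue field; stated here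
as a hypothesis `hq`). Proof: `KgK/K ≅ K / Stab_K(gK)` (Mathlib's orbit–stabiliser bijection),
and `Stab_K(gK) ⊇ φ(K(c))` for the `c` of `T5CongruenceConjugation` (`g⁻¹ K(c) g ⊆ K`), where
`K(c)` has finite index in `GL_n(R)` (`T5CongruenceKernel`) and surjects onto its image in `K`.

* `rangeRestrict_mem_stabilizer` — `g⁻¹ φ(k₀) g ∈ K ⇒ φ(k₀)` stabilises the coset `gK`;
* `finiteIndex_stabilizer_of_finite_quotients` — `Stab_K(gK)` has finite index in `K` under `(Q)`;
* `finite_orbit_of_finite_quotients` — **`KgK/K` is finite** under `(Q)` (the algebraic counterpart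
  of T5-53's topological `finite_orbit_coset_of_isOpen_of_isCompact`, which needs `K` compact open);
* `heckeAlgebra_mul_comm_of_finite_quotients` — **`H(GL_n(F), GL_n(R))` is commutative** for
  every PID `R` satisfying `(Q)` (T5-101's theorem with `hfin` discharged).

Hypotheses as stated in the kernel: `R` a commutative domain (a PID for the last theorem), `F` a
field with `[Algebra R F] [IsFractionRing R F]`, `ι` a finite type with decidable equality,
`hq : ∀ c : R, c ≠ 0 → Finite (R ⧸ Ideal.span {c})`, `k` the coefficient field.
-/

namespace Summit.Ventures.HodgeRepro2.T5CongruenceOrbitFinite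

open Matrix

variable {R : Type*} [CommRing R] {F : Type*} [Field F] [Algebra R F]
variable {ι : Type*} [Fintype ι] [DecidableEq ι]

/-- If `g⁻¹ φ(k₀) g ∈ K` then `φ(k₀)`, as an element of `K`, fixes the coset `gK`. -/
theorem rangeRestrict_mem_stabilizer (g : GL ι F) (k₀ : GL ι R)
    (h : g⁻¹ * Matrix.GeneralLinearGroup.map (algebraMap R F) k₀ * g ∈
      (Matrix.GeneralLinearGroup.map (n := ι) (algebraMap R F)).range) :
    (Matrix.GeneralLinearGroup.map (n := ι) (algebraMap R F)).rangeRestrict k₀ ∈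
      MulAction.stabilizer (Matrix.GeneralLinearGroup.map (n := ι) (algebraMap R F)).range
        (g : GL ι F ⧸ (Matrix.GeneralLinearGroup.map (n := ι) (algebraMap R F)).range) := by
  set K : Subgroup (GL ι F) := (Matrix.GeneralLinearGroup.map (n := ι) (algebraMap R F)).range
    with hK
  rw [MulAction.mem_stabilizer_iff]
  change ((Matrix.GeneralLinearGroup.map (algebraMap R F) k₀ * g : GL ι F) : GL ι F ⧸ K) =
    (g : GL ι F ⧸ K)
  rw [QuotientGroup.eq]
  have h' := Subgroup.inv_mem _ h
  have e : (g⁻¹ * Matrix.GeneralLinearGroup.map (algebraMap R F) k₀ * g)⁻¹ =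
      (Matrix.GeneralLinearGroup.map (algebraMap R F) k₀ * g)⁻¹ * g := by
    simp only [_root_.mul_inv_rev, inv_inv, mul_assoc]
  rw [e] at h'
  exact h'

variable [IsDomain R] [IsFractionRing R F]

/-- Under `(Q)`, the stabiliser in `K = GL_n(R)` of the coset `gK` has finite index in `K`:
it contains the image of the congruence subgroup `K(c)` of `T5CongruenceConjugation`. -/
theorem finiteIndex_stabilizer_of_finite_quotients
    (hq : ∀ c : R, c ≠ 0 → Finite (R ⧸ Ideal.span {c})) (g : GL ι F) :
    (MulAction.stabilizer (Matrix.GeneralLinearGroup.map (n := ι) (algebraMap R F)).range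
      (g : GL ι F ⧸
        (Matrix.GeneralLinearGroup.map (n := ι) (algebraMap R F)).range)).FiniteIndex := by
  obtain ⟨c, hc, hconj⟩ := T5CongruenceConjugation.exists_conj_ker_le_range (R := R) g
  haveI : Finite (R ⧸ Ideal.span {c}) := hq c hc
  haveI hker : (Matrix.GeneralLinearGroup.map (n := ι)
      (Ideal.Quotient.mk (Ideal.span {c}))).ker.FiniteIndex :=
    T5CongruenceKernel.finiteIndex_ker_map_mk _
  haveI hmap : ((Matrix.GeneralLinearGroup.map (n := ι)
      (Ideal.Quotient.mk (Ideal.span {c}))).ker.map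
      (Matrix.GeneralLinearGroup.map (n := ι) (algebraMap R F)).rangeRestrict).FiniteIndex := by
    rw [Subgroup.finiteIndex_iff]
    intro h0
    have hdvd := Subgroup.index_map_dvd
      (H := (Matrix.GeneralLinearGroup.map (n := ι) (Ideal.Quotient.mk (Ideal.span {c}))).ker)
      (MonoidHom.rangeRestrict_surjective
        (Matrix.GeneralLinearGroup.map (n := ι) (algebraMap R F)))
    rw [h0, zero_dvd_iff] at hdvd
    exact hker.index_ne_zero hdvd
  have hle : (Matrix.GeneralLinearGroup.map (n := ι)
      (Ideal.Quotient.mk (Ideal.span {c}))).ker.map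
      (Matrix.GeneralLinearGroup.map (n := ι) (algebraMap R F)).rangeRestrict ≤
      MulAction.stabilizer (Matrix.GeneralLinearGroup.map (n := ι) (algebraMap R F)).range
        (g : GL ι F ⧸ (Matrix.GeneralLinearGroup.map (n := ι) (algebraMap R F)).range) := by
    rintro _ ⟨k₀, hk₀, rfl⟩
    exact rangeRestrict_mem_stabilizer g k₀ (hconj k₀ hk₀)
  exact Subgroup.finiteIndex_of_le hle

/-- **`KgK/K` is finite** for `K = GL_n(R) ⊂ GL_n(F)` under `(Q)`: the orbit of `gK` under `K`
is in bijection with `K / Stab_K(gK)`, of finite index. -/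
theorem finite_orbit_of_finite_quotients
    (hq : ∀ c : R, c ≠ 0 → Finite (R ⧸ Ideal.span {c})) (g : GL ι F) :
    Finite (MulAction.orbit (Matrix.GeneralLinearGroup.map (n := ι) (algebraMap R F)).range
      (g : GL ι F ⧸ (Matrix.GeneralLinearGroup.map (n := ι) (algebraMap R F)).range)) := by
  haveI := finiteIndex_stabilizer_of_finite_quotients hq g
  exact Finite.of_equiv _ (MulAction.orbitEquivQuotientStabilizer
    (Matrix.GeneralLinearGroup.map (n := ι) (algebraMap R F)).range _).symm

variable [IsPrincipalIdealRing R]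

/-- **`H(GL_n(F), GL_n(R))` is commutative** for every principal ideal domain `R` whose non-zero
principal quotients are finite (the record's `𝒪_v`): Gelfand's trick with the transpose
(T5-101), the Cartan decomposition (T5-100) and the finiteness of `KgK/K`
(`finite_orbit_of_finite_quotients`). -/
theorem heckeAlgebra_mul_comm_of_finite_quotients (k : Type*) [Field k]
    (hq : ∀ c : R, c ≠ 0 → Finite (R ⧸ Ideal.span {c}))
    (T S : T5HeckePermutationModule.heckeAlgebra k
      (Matrix.GeneralLinearGroup.map (n := ι) (algebraMap R F)).range) :
    T * S = S * T :=
  T5CartanTransposeGelfand.heckeAlgebra_mul_comm k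
    (fun g => finite_orbit_of_finite_quotients hq g) T S

end Summit.Ventures.HodgeRepro2.T5CongruenceOrbitFinite
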